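import Summits.QuantumFields.YangMills.Theorems.UnitScaleTiltProp7CovWeightedLaplaceRow
import Summits.QuantumFields.YangMills.Theorems.UnitScaleTiltProp7MemberBallFrames
import Summits.QuantumFields.YangMills.Theorems.UnitScaleTiltProp7CovInterpErrorLocalLaplaceEnergyT3
import Summits.QuantumFields.YangMills.Theorems.UnitScaleTiltProp7CovHodgeSplit
import HarnessLib

/-!
# Route `UnitScaleTilt`, crux K1 «MinimiserStabilityRegPr» (stmt-QuantumFields-19200), route-R E′ path (α′), (E1-b) covariant, row (hK₂-cov) — FILE F4c-cov «THE MEMBER PLUG»: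
# the `hK₂sup` binder of routeR-w3 g6's CLOSE ✓ `Prop7LinearCorrectorClose.linCorr_gauge_le_of_supplier_rows`, AT THE MEMBER OF RECORD (`W ∈ RegPr`, `M·α₀ ≤ a₅`, px4 g3's window row),
# with an absolute `C₂`: `w(x)·‖Δ_𝒰(φ − φ_H)(x)‖ ≤ C₂·ℓ_k·M` for every admissible weight — frames, mass and cutoff ALL DISCHARGED

Cell `ym3-torus`, width seat `ym3-torus-px11` (gen 3), LEAD of the (hK₂-cov) chain (routeR-w3 g6 WORDS (8)–(10), THE CUT 22:51:18Z: F4b∕F4c = px11); LOCATE 19200 evidence #57.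
`--kind proof --supports stmt-QuantumFields-19200 --as helper`, count-neutral.  THEOREMS ONLY (0 `def`, 0 `sorry`).  YM₃ on T³ is a ladder rung (R3) — not d = 4, not infinite
volume, not a mass gap, not the Clay problem; nothing here claims the stub, the crux or the gap.

THE POINT.  ✓ `Prop7CovWeightedLaplaceRow.weight_mul_norm_covLaplace_interp_error_le` (F4b-cov (iii)) gives the weighted row on a generic torus with two displayed member data —
the (3.35) frames on the pin balls (`τ₁ ≤ t∕ℓ`, `τ₂ ≤ t∕ℓ²`) and the local `hs`-mass `𝓜` of `Δ_𝒰φ_H` on `ℓ`-balls.  At the member both are theorems of px4 g3: ✓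
`Prop7MemberBallFrames.exists_ballFrame_of_regPr` (frames on every `tdist`-ball of radius `r` with `2r + 4 ≤ bigSide`, here `r = ℓ_k` by ✓ `forty_mul_le_bigSide`; `t = C′e^{C′∕ℓ_k} ≤
T₀ := c₃₅a₅e^{c₃₅a₅}`) and ✓ `Prop7CovInterpErrorLocalLaplaceEnergyT3.sum_ball_hs_covLaplace_interp_error_le_T3` (local `hs`-energy of `Δ_𝒰(φ − φ_H)` on the `ℓ_k`-ball
`≤ C_E·e·ℓ_k³·M_φ²`; with `hs(Δ_𝒰φ) ≤ 2M²` (✓ `Prop7CovariantCoercivity.sum_norm_sq_le_mul_opNorm_sq`), `hs(Δ_𝒰φ_H) ≤ 2hs(Δ_𝒰φ) + 2hs(Δ_𝒰(φ−φ_H))` and `#B(ℓ_k) ≤ 27ℓ_k³`: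
`𝓜 ≤ (108 + 4e·C_E)·ℓ_k³·M²`).  Plugging: `w·‖Δ_𝒰(φ−φ_H)‖ ≤ ℓ_kM + A·81·(1+T₀)²·√(108 + 4eC_E)·ℓ_k·M`, i.e. the `hK₂sup` row with `C₂ := 1 + 81A(1+T₀)²√(108 + 4eC_E)`.
Left displayed (the member's standing data, as in every (E1-b) supplier): `RegPr`, `M·α₀ ≤ a₅`, `α₀ ≤ 1`, px4's window row (verbatim from ✓p674614), and the scale floor `1024 ≤ L^{K−n}`.

WHAT IS PROVED (ns `…Theorems.Prop7CovWeightedRowMember`; member `PV 2 ℓ m K hd3 hL` = `(⟨ℓ+1, hL, m, hm⟩ : T3Family).P K`, `𝒰 := fun κ z => unitsField (toUField W) ⟨z, κ⟩`, `ℓ_k = (ℓ+1)^{K−n}`).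
* §1 letters `ball_real_pow_eq_nat`, `sum_hs_covLaplace_le_of_error`, `frame_scalings`, `final_algebra`; §2 ★★ `member_frames`, ★★ `member_mass` (px4 g3's bricks in F4b's letters).
* §3 ★★★ `weight_row_member` — `∃ c₃₅ a₅ C₂ > 0, ∀ member data, RegPr → window → ∀ φ φ_H (pinned, biharmonic off the centres) M (‖Δ_𝒰φ‖ ≤ M) w (admissible) x, w x·‖Δ_𝒰(φ−φ_H) x‖ ≤ C₂·ℓ_k·M`
  — the `hK₂sup` binder of ✓ `linCorr_gauge_le_of_supplier_rows` for `F = ⟨ℓ+1, hL, m, hm⟩` (definitionally `F.P K = PV 2 ℓ m K hd3 hL`, `F.L = ℓ + 1`).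
HONEST SCOPE.  Bookkeeping over landed bricks; nothing of Bałaban's is asserted; routeR-w3 g6's close converts door letters only.

References: T. Bałaban, CMP 102 (1985) 277–309 [Balaban1985Variational] (Prop. 7 p.299); CMP 99 (1985) 389–434 [Balaban1985BackgroundPropagators] ((3.8) p.392, (3.35) p.396);
CMP 99 (1985) 75–102 [Balaban1985RegularSpaces] ((1.33) p.82).
-/

set_option autoImplicit false

noncomputable section

open scoped BigOperators Matrix.Norms.L2Operator Matrix

namespace Summit.QuantumFields.YangMills.Theorems.Prop7CovWeightedRowMember

open Literature.MathematicalPhysics.QuantumFieldTheory.Balaban1983to89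
open Literature.MathematicalPhysics.QuantumFieldTheory.Balaban1983to89.T3ContinuumYM3Torus
open Literature.MathematicalPhysics.QuantumFieldTheory.Balaban1983to89.T3PrintedRegularMinimiser (RegPr)
open Literature.MathematicalPhysics.QuantumFieldTheory.Balaban1983to89.B6GlobalChartV1 (PV)
open Finset
open B9Eq39Adjoint (covD divB)
open B9TorusCalculus (torusT)
open B10Eq27TorusAxialLog (unitsField toUField)
open B15DeterminingSets (embIter)
open B6MultiLevelBoxOperator (bigSide)
open B3Taylor310LocalRemainder (tdist_self)
open Summit.QuantumFields.YangMills.Theorems.Prop7SectET3Members (hd3)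
open Summit.QuantumFields.YangMills.Theorems.Prop7MemberBallFrames (exists_ballFrame_of_regPr forty_mul_le_bigSide)
open Summit.QuantumFields.YangMills.Theorems.Prop7CovInterpErrorLocalLaplaceEnergyT3 (sum_ball_hs_covLaplace_interp_error_le_T3)
open Summit.QuantumFields.YangMills.Theorems.Prop7CovHodgeSplit (unitsField_toUField_mem_unitary)
open Summit.QuantumFields.YangMills.Theorems.Prop7ExactCorrectorGaugeSockets (unitsField_toUField_norm_le_one)
open Summit.QuantumFields.YangMills.Theorems.Prop7CovariantCoercivity (sum_norm_sq_sub_le sum_norm_sq_le_mul_opNorm_sq)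
open Summit.QuantumFields.YangMills.Theorems.Prop7CovInterpKernelDual (covLaplace_sub)
open Summit.QuantumFields.YangMills.Theorems.Prop7TorusRadialSums (card_ball_le_real)
open Summit.QuantumFields.YangMills.Theorems.Prop7CovWeightedRowScalings (sqrt_letters)
open Summit.QuantumFields.YangMills.Theorems.Prop7CovWeightedLaplaceRow (weight_mul_norm_covLaplace_interp_error_le)

/-! ## §1 Letters -/

section Letters

variable {N : ℕ}

variable {P : Params} {j : ℕ}

/-- The real-radius ball at the radius `L^k` is the integer-radius ball. [folklore] -/
theorem ball_real_pow_eq_nat (x₀ : Site P j) (L k : ℕ) :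
    Finset.univ.filter (fun z : Site P j => (Site.tdist z x₀ : ℝ) ≤ ((L : ℕ) : ℝ) ^ k) = Finset.univ.filter (fun z : Site P j => Site.tdist z x₀ ≤ L ^ k) := by
  ext z
  simp only [Finset.mem_filter, Finset.mem_univ, true_and]
  rw [← Nat.cast_pow, Nat.cast_le]

/-- **THE MASS ALGEBRA** (generic torus): `Σ_B hs(Δ_Uφ_H) ≤ 2·#B·(N·M²) + 2·Σ_B hs(Δ_U(φ − φ_H))` when `‖Δ_Uφ‖ ≤ M` pointwise. [cite: Balaban1985BackgroundPropagators, (3.8) p.392] -/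
theorem sum_hs_covLaplace_le_of_error (U : Fin P.d → Site P j → (Matrix (Fin N) (Fin N) ℂ)ˣ) (φ φH : Site P j → Matrix (Fin N) (Fin N) ℂ) {M : ℝ}
    (hM : ∀ z, ‖divB (torusT P j) U (fun μ => covD (torusT P j) U μ φ) z‖ ≤ M) (B : Finset (Site P j)) :
    ∑ z ∈ B, ∑ j' : Fin N, ∑ k' : Fin N, ‖(divB (torusT P j) U (fun ν => covD (torusT P j) U ν φH) z) j' k'‖ ^ 2
      ≤ 2 * (B.card : ℝ) * ((N : ℝ) * M ^ 2)
        + 2 * ∑ z ∈ B, ∑ j' : Fin N, ∑ k' : Fin N, ‖(divB (torusT P j) U (fun μ => covD (torusT P j) U μ (fun y => φ y - φH y)) z) j' k'‖ ^ 2 := by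
  have hpt : ∀ z, ∑ j' : Fin N, ∑ k' : Fin N, ‖(divB (torusT P j) U (fun ν => covD (torusT P j) U ν φH) z) j' k'‖ ^ 2
      ≤ 2 * ((N : ℝ) * M ^ 2) + 2 * ∑ j' : Fin N, ∑ k' : Fin N, ‖(divB (torusT P j) U (fun μ => covD (torusT P j) U μ (fun y => φ y - φH y)) z) j' k'‖ ^ 2 := by
    intro z
    have hsub := covLaplace_sub (U := U) φ φH z
    have e : divB (torusT P j) U (fun ν => covD (torusT P j) U ν φH) z
        = divB (torusT P j) U (fun μ => covD (torusT P j) U μ φ) z - divB (torusT P j) U (fun μ => covD (torusT P j) U μ (fun y => φ y - φH y)) z := by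
      rw [hsub]; abel
    rw [e]
    have h := sum_norm_sq_sub_le (divB (torusT P j) U (fun μ => covD (torusT P j) U μ φ) z)
      (divB (torusT P j) U (fun μ => covD (torusT P j) U μ (fun y => φ y - φH y)) z)
    have hφ : ∑ j' : Fin N, ∑ k' : Fin N, ‖(divB (torusT P j) U (fun μ => covD (torusT P j) U μ φ) z) j' k'‖ ^ 2 ≤ (N : ℝ) * M ^ 2 :=
      (sum_norm_sq_le_mul_opNorm_sq _).trans (mul_le_mul_of_nonneg_left (pow_le_pow_left₀ (norm_nonneg _) (hM z) 2) (Nat.cast_nonneg N))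
    linarith
  refine (Finset.sum_le_sum fun z _ => hpt z).trans (le_of_eq ?_)
  rw [Finset.sum_add_distrib, Finset.sum_const, ← Finset.mul_sum, nsmul_eq_mul]; ring

omit N P j in
/-- The member's frame rows in the `t`-letters: with `C′ ≥ 0`, `ℓ ≥ 1`, `t := C′·e^{C′∕ℓ}`: `ℓ⁻¹C′e^{ℓ⁻¹C′} ≤ t∕ℓ`, `ℓ⁻¹(ℓ⁻¹C′)e^{ℓ⁻¹C′} ≤ t∕ℓ²`, `0 ≤ t`, and `t ≤ C″e^{C″}` for `C′ ≤ C″`.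
[cite: Balaban1985BackgroundPropagators, (3.35) p.396] -/
theorem frame_scalings {C' C'' ℓ : ℝ} (hC0 : 0 ≤ C') (hC : C' ≤ C'') (hℓ : 1 ≤ ℓ) :
    ℓ⁻¹ * C' * Real.exp (ℓ⁻¹ * C') ≤ C' * Real.exp (ℓ⁻¹ * C') / ℓ ∧
      ℓ⁻¹ * (ℓ⁻¹ * C') * Real.exp (ℓ⁻¹ * C') ≤ C' * Real.exp (ℓ⁻¹ * C') / ℓ ^ 2 ∧
      0 ≤ C' * Real.exp (ℓ⁻¹ * C') ∧ C' * Real.exp (ℓ⁻¹ * C') ≤ C'' * Real.exp C'' := by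
  have hℓ0 : 0 < ℓ := by linarith
  refine ⟨le_of_eq (by field_simp), le_of_eq (by field_simp), by positivity, ?_⟩
  have hinv : ℓ⁻¹ ≤ 1 := inv_le_one_of_one_le₀ hℓ
  have h1 : ℓ⁻¹ * C' ≤ C'' := (mul_le_of_le_one_left hC0 hinv).trans hC
  exact mul_le_mul hC (Real.exp_le_exp.2 h1) (Real.exp_pos _).le (hC0.trans hC)

omit N P j in
/-- The final algebra of the member plug: `ℓM + 81A(1+t)²·√(C_V ℓ³M²)∕√ℓ ≤ (1 + 81A(1+T₀)²√C_V)·ℓ·M`. [folklore] -/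
theorem final_algebra {A T₀ t CV ℓ M : ℝ} (hA : 0 ≤ A) (ht0 : 0 ≤ t) (ht : t ≤ T₀) (hCV : 0 ≤ CV) (hℓ : 1 ≤ ℓ) (hM : 0 ≤ M) :
    ℓ * M + A * 81 * (1 + t) ^ 2 * Real.sqrt (CV * ℓ ^ 3 * M ^ 2) / Real.sqrt ℓ ≤ (1 + A * 81 * (1 + T₀) ^ 2 * Real.sqrt CV) * ℓ * M := by
  obtain ⟨hr1, -, -, hr3⟩ := sqrt_letters hℓ
  have hr0 : 0 < Real.sqrt ℓ := by linarith
  have hsq : Real.sqrt (CV * ℓ ^ 3 * M ^ 2) = Real.sqrt CV * (ℓ * Real.sqrt ℓ) * M := by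
    rw [Real.sqrt_mul (by positivity), Real.sqrt_mul (by positivity), hr3, Real.sqrt_sq hM]
  rw [hsq]
  have e : A * 81 * (1 + t) ^ 2 * (Real.sqrt CV * (ℓ * Real.sqrt ℓ) * M) / Real.sqrt ℓ = A * 81 * (1 + t) ^ 2 * (Real.sqrt CV * ℓ * M) := by
    field_simp
  rw [e]
  have hT : (1 + t) ^ 2 ≤ (1 + T₀) ^ 2 := pow_le_pow_left₀ (by positivity) (by linarith) 2
  have h0 : 0 ≤ Real.sqrt CV * ℓ * M := by positivity
  have h1 := mul_le_mul_of_nonneg_right (mul_le_mul_of_nonneg_left hT (by positivity : (0:ℝ) ≤ A * 81)) h0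
  have e2 : (1 + A * 81 * (1 + T₀) ^ 2 * Real.sqrt CV) * ℓ * M = ℓ * M + A * 81 * (1 + T₀) ^ 2 * (Real.sqrt CV * ℓ * M) := by ring
  rw [e2]; linarith

end Letters

/-! ## §2 The member's frames and mass in F4b's letters -/

section MemberData

variable {ℓ : ℕ} {hL : Odd (ℓ + 1) ∧ 1 < ℓ + 1}

/-- ★★ **THE MEMBER'S FRAMES IN THE `t`-LETTERS**: px4 g3's ✓ `exists_ballFrame_of_regPr` on every pin ball of radius `ℓ_k` (`2ℓ_k + 4 ≤ bigSide` by ✓ `forty_mul_le_bigSide`), with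
`τ₁ ≤ t∕ℓ_k`, `τ₂ ≤ t∕ℓ_k²`, `0 ≤ t ≤ T₀ := c₃₅a₅e^{c₃₅a₅}` (`t = C′e^{C′∕ℓ_k}`, `C′ = c₃₅Mα₀ ≤ c₃₅a₅`). [cite: Balaban1985BackgroundPropagators, (3.35) p.396; Balaban1985RegularSpaces, (1.33) p.82] -/
theorem member_frames (hℓ4 : 4 ≤ ℓ) : ∃ a₅ T₀ : ℝ, 0 < a₅ ∧ 0 ≤ T₀ ∧
    ∀ (hℓ : 4 ≤ ℓ) (m : ℕ) (hm : 1 ≤ m) (n K a' R : ℕ) (hk1 : 1 ≤ K - n) (hsize : a' + 3 ≤ m + n) (hM8 : 8 ≤ (ℓ + 1) ^ a')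
      (hR2 : 2 * (ℓ + 1) ^ 2 ≤ R) (α₀ : ℝ), 0 < α₀ → ((ℓ + 1 : ℕ) : ℝ) * (((ℓ + 1) ^ a' : ℕ) : ℝ) * α₀ ≤ a₅ →
      ∀ W : GaugeField (PV 2 ℓ m K hd3 hL) 0 (Matrix.specialUnitaryGroup (Fin 2) ℂ),
        RegPr (⟨ℓ + 1, hL, m, hm⟩ : T3Family) n K α₀ W →
        ∃ t τ₁ τ₂ : ℝ, 0 ≤ t ∧ t ≤ T₀ ∧ τ₁ ≤ t / (((PV 2 ℓ m K hd3 hL).L : ℝ)) ^ (K - n) ∧ τ₂ ≤ t / ((((PV 2 ℓ m K hd3 hL).L : ℝ)) ^ (K - n)) ^ 2 ∧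
          ∀ y₀ : Site (PV 2 ℓ m K hd3 hL) (K - n), ∃ Fr : Site (PV 2 ℓ m K hd3 hL) 0 → (Matrix (Fin 2) (Fin 2) ℂ)ˣ,
            (∀ z, ‖(Fr z : Matrix (Fin 2) (Fin 2) ℂ)‖ ≤ 1 ∧ ‖(((Fr z)⁻¹ : (Matrix (Fin 2) (Fin 2) ℂ)ˣ) : Matrix (Fin 2) (Fin 2) ℂ)‖ ≤ 1) ∧
            (∀ (μ : Fin (PV 2 ℓ m K hd3 hL).d) (z : Site (PV 2 ℓ m K hd3 hL) 0), Site.tdist z (embIter (K - n) y₀) ≤ (PV 2 ℓ m K hd3 hL).L ^ (K - n) →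
              ‖(((Fr z)⁻¹ * (fun κ z => unitsField (toUField W) ⟨z, κ⟩) μ z * Fr (torusT (PV 2 ℓ m K hd3 hL) 0 μ z) : (Matrix (Fin 2) (Fin 2) ℂ)ˣ) : Matrix (Fin 2) (Fin 2) ℂ) - 1‖ ≤ τ₁) ∧
            (∀ (μ ν : Fin (PV 2 ℓ m K hd3 hL).d) (z : Site (PV 2 ℓ m K hd3 hL) 0), Site.tdist z (embIter (K - n) y₀) ≤ (PV 2 ℓ m K hd3 hL).L ^ (K - n) →
              ‖(((Fr (torusT (PV 2 ℓ m K hd3 hL) 0 ν z))⁻¹ * (fun κ z => unitsField (toUField W) ⟨z, κ⟩) μ (torusT (PV 2 ℓ m K hd3 hL) 0 ν z)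
                    * Fr (torusT (PV 2 ℓ m K hd3 hL) 0 μ (torusT (PV 2 ℓ m K hd3 hL) 0 ν z)) : (Matrix (Fin 2) (Fin 2) ℂ)ˣ) : Matrix (Fin 2) (Fin 2) ℂ)
                - (((Fr z)⁻¹ * (fun κ z => unitsField (toUField W) ⟨z, κ⟩) μ z * Fr (torusT (PV 2 ℓ m K hd3 hL) 0 μ z) : (Matrix (Fin 2) (Fin 2) ℂ)ˣ) : Matrix (Fin 2) (Fin 2) ℂ)‖ ≤ τ₂) := by
  obtain ⟨c35f, a₅f, hc35f, ha₅f, Hfr⟩ := exists_ballFrame_of_regPr (hL := hL) hℓ4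
  refine ⟨a₅f, c35f * a₅f * Real.exp (c35f * a₅f), ha₅f, by positivity, ?_⟩
  intro hℓ m hm n K a' R hk1 hsize hM8 hR2 α₀ hα₀ hMα W hreg
  have hℓk1 : (1 : ℝ) ≤ ((ℓ + 1 : ℕ) : ℝ) ^ (K - n) := one_le_pow₀ (by exact_mod_cast Nat.succ_le_succ (Nat.zero_le ℓ))
  have hPL : (((PV 2 ℓ m K hd3 hL).L : ℝ)) ^ (K - n) = ((ℓ + 1 : ℕ) : ℝ) ^ (K - n) := rfl
  have hC'0 : 0 ≤ c35f * (((ℓ + 1 : ℕ) : ℝ) * (((ℓ + 1) ^ a' : ℕ) : ℝ)) * α₀ := by positivity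
  have hC'le : c35f * (((ℓ + 1 : ℕ) : ℝ) * (((ℓ + 1) ^ a' : ℕ) : ℝ)) * α₀ ≤ c35f * a₅f := by
    rw [mul_assoc]; exact mul_le_mul_of_nonneg_left hMα hc35f.le
  obtain ⟨hτ₁, hτ₂, ht0, htT⟩ := frame_scalings hC'0 hC'le hℓk1
  refine ⟨c35f * (((ℓ + 1 : ℕ) : ℝ) * (((ℓ + 1) ^ a' : ℕ) : ℝ)) * α₀
            * Real.exp ((((ℓ + 1 : ℕ) : ℝ) ^ (K - n))⁻¹ * (c35f * (((ℓ + 1 : ℕ) : ℝ) * (((ℓ + 1) ^ a' : ℕ) : ℝ)) * α₀)),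
          (((ℓ + 1 : ℕ) : ℝ) ^ (K - n))⁻¹ * (c35f * (((ℓ + 1 : ℕ) : ℝ) * (((ℓ + 1) ^ a' : ℕ) : ℝ)) * α₀)
            * Real.exp ((((ℓ + 1 : ℕ) : ℝ) ^ (K - n))⁻¹ * (c35f * (((ℓ + 1 : ℕ) : ℝ) * (((ℓ + 1) ^ a' : ℕ) : ℝ)) * α₀)),
          (((ℓ + 1 : ℕ) : ℝ) ^ (K - n))⁻¹ * ((((ℓ + 1 : ℕ) : ℝ) ^ (K - n))⁻¹ * (c35f * (((ℓ + 1 : ℕ) : ℝ) * (((ℓ + 1) ^ a' : ℕ) : ℝ)) * α₀))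
            * Real.exp ((((ℓ + 1 : ℕ) : ℝ) ^ (K - n))⁻¹ * (c35f * (((ℓ + 1 : ℕ) : ℝ) * (((ℓ + 1) ^ a' : ℕ) : ℝ)) * α₀)),
          ht0, htT, ?_, ?_, fun y₀ => ?_⟩
  · rw [hPL]; exact hτ₁
  · rw [hPL]; exact hτ₂
  have hbig : 2 * (ℓ + 1) ^ (K - n) + 4 ≤ bigSide ℓ ((ℓ + 1) ^ a') (K - n) := by
    have h40 := forty_mul_le_bigSide hℓ (K := K) (n := n) hM8
    have h1 : 1 ≤ (ℓ + 1) ^ (K - n) := Nat.one_le_pow _ _ (by omega)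
    omega
  obtain ⟨Fr, hFr, h1, h2⟩ := Hfr hℓ m hm n K a' R hk1 hsize hM8 hR2 α₀ hα₀ hMα W hreg (embIter (K - n) y₀) ((ℓ + 1) ^ (K - n)) hbig
  exact ⟨Fr, hFr, fun μ z hz => by simpa only using h1 μ z hz, fun μ ν z hz => by simpa only using h2 μ ν z hz⟩

/-- ★★ **THE MEMBER'S LOCAL MASS OF `Δ_𝒰φ_H`**: `Σ_{tdist(z,x₀) ≤ ℓ_k} hs(Δ_𝒰φ_H z) ≤ C_V·ℓ_k³·M²`, `C_V = 108 + 4e·C_E`, from px4 g3's ✓ `sum_ball_hs_covLaplace_interp_error_le_T3` (`R_b = ℓ_k`,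
`M_φ = √2·M`), `hs(Δ_𝒰φ_H) ≤ 2hs(Δ_𝒰φ) + 2hs(Δ_𝒰(φ−φ_H))`, `hs ≤ 2‖·‖²` and `#B(ℓ_k) ≤ 27ℓ_k³`. [cite: Balaban1984PropagatorsII, (1.9) p.226; Balaban1985BackgroundPropagators, (3.8) p.392] -/
theorem member_mass (hℓ4 : 4 ≤ ℓ) : ∃ c35 a₅ CV : ℝ, 0 < c35 ∧ 0 < a₅ ∧ 0 < CV ∧
    ∀ (hℓ : 4 ≤ ℓ) (m : ℕ) (hm : 1 ≤ m) (n K a' R : ℕ) (hk1 : 1 ≤ K - n) (hsize : a' + 3 ≤ m + n) (hM8 : 8 ≤ (ℓ + 1) ^ a')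
      (hR2 : 2 * (ℓ + 1) ^ 2 ≤ R) (α₀ : ℝ), 0 < α₀ → α₀ ≤ 1 → ((ℓ + 1 : ℕ) : ℝ) * (((ℓ + 1) ^ a' : ℕ) : ℝ) * α₀ ≤ a₅ →
      ∀ W : GaugeField (PV 2 ℓ m K hd3 hL) 0 (Matrix.specialUnitaryGroup (Fin 2) ℂ),
        RegPr (⟨ℓ + 1, hL, m, hm⟩ : T3Family) n K α₀ W →
        (4 * 2197 * (24 * 289 * 24576 * 46116) : ℝ) * ((2 : ℕ) : ℝ) ^ 2 * ((((PV 2 ℓ m K hd3 hL).L : ℝ)) ^ (K - n)) ^ 4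
            * ((((PV 2 ℓ m K hd3 hL).d : ℝ)) ^ 2 * (4 * ((2 : ℕ) : ℝ) * (α₀ * ((((PV 2 ℓ m K hd3 hL).L : ℝ))⁻¹) ^ (2 * (K - n))) ^ 2
              + (2 * ((((ℓ + 1 : ℕ) : ℝ) ^ (K - n))⁻¹ * ((((ℓ + 1 : ℕ) : ℝ) ^ (K - n))⁻¹ * (c35 * (((ℓ + 1 : ℕ) : ℝ) * (((ℓ + 1) ^ a' : ℕ) : ℝ)) * α₀))
                  * Real.exp ((((ℓ + 1 : ℕ) : ℝ) ^ (K - n))⁻¹ * (c35 * (((ℓ + 1 : ℕ) : ℝ) * (((ℓ + 1) ^ a' : ℕ) : ℝ)) * α₀)))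
                + 4 * ((((ℓ + 1 : ℕ) : ℝ) ^ (K - n))⁻¹ * (c35 * (((ℓ + 1 : ℕ) : ℝ) * (((ℓ + 1) ^ a' : ℕ) : ℝ)) * α₀)
                  * Real.exp ((((ℓ + 1 : ℕ) : ℝ) ^ (K - n))⁻¹ * (c35 * (((ℓ + 1 : ℕ) : ℝ) * (((ℓ + 1) ^ a' : ℕ) : ℝ)) * α₀))) ^ 2) ^ 2)) ≤ 1 / 4 →
        ∀ (φ φH : Site (PV 2 ℓ m K hd3 hL) 0 → Matrix (Fin 2) (Fin 2) ℂ),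
          (∀ y : Site (PV 2 ℓ m K hd3 hL) (K - n), φH (embIter (K - n) y) = φ (embIter (K - n) y)) →
          (∀ x : Site (PV 2 ℓ m K hd3 hL) 0, x ∉ Set.range (embIter (P := PV 2 ℓ m K hd3 hL) (K - n)) →
            divB (torusT (PV 2 ℓ m K hd3 hL) 0) (fun κ z => unitsField (toUField W) ⟨z, κ⟩) (fun μ => covD (torusT (PV 2 ℓ m K hd3 hL) 0) (fun κ z => unitsField (toUField W) ⟨z, κ⟩) μ
                (fun y => divB (torusT (PV 2 ℓ m K hd3 hL) 0) (fun κ z => unitsField (toUField W) ⟨z, κ⟩) (fun ν => covD (torusT (PV 2 ℓ m K hd3 hL) 0) (fun κ z => unitsField (toUField W) ⟨z, κ⟩) ν φH) y)) x = 0) →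
          ∀ M : ℝ, (∀ z, ‖divB (torusT (PV 2 ℓ m K hd3 hL) 0) (fun κ z => unitsField (toUField W) ⟨z, κ⟩) (fun μ => covD (torusT (PV 2 ℓ m K hd3 hL) 0) (fun κ z => unitsField (toUField W) ⟨z, κ⟩) μ φ) z‖ ≤ M) →
          ∀ x₀ : Site (PV 2 ℓ m K hd3 hL) 0,
            ∑ z ∈ Finset.univ.filter (fun z : Site (PV 2 ℓ m K hd3 hL) 0 => Site.tdist z x₀ ≤ (PV 2 ℓ m K hd3 hL).L ^ (K - n)),
              ∑ j' : Fin 2, ∑ k' : Fin 2, ‖(divB (torusT (PV 2 ℓ m K hd3 hL) 0) (fun κ z => unitsField (toUField W) ⟨z, κ⟩) (fun ν => covD (torusT (PV 2 ℓ m K hd3 hL) 0) (fun κ z => unitsField (toUField W) ⟨z, κ⟩) ν φH) z) j' k'‖ ^ 2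
              ≤ CV * ((((PV 2 ℓ m K hd3 hL).L : ℝ)) ^ (K - n)) ^ 3 * M ^ 2 := by
  classical
  obtain ⟨c35, a₅m, κ₀, CE, hc35, ha₅m, -, hCE, Hmass⟩ := sum_ball_hs_covLaplace_interp_error_le_T3 (hL := hL) hℓ4
  refine ⟨c35, a₅m, 108 + 4 * Real.exp 1 * CE, hc35, ha₅m, by positivity, ?_⟩
  intro hℓ m hm n K a' R hk1 hsize hM8 hR2 α₀ hα₀ hα1 hMα W hreg hwin φ φH hH hEL M hM x₀
  obtain ⟨ℓk, hℓk⟩ : ∃ ℓk : ℝ, ℓk = ((ℓ + 1 : ℕ) : ℝ) ^ (K - n) := ⟨_, rfl⟩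
  have hℓk1 : 1 ≤ ℓk := by rw [hℓk]; exact one_le_pow₀ (by exact_mod_cast Nat.succ_le_succ (Nat.zero_le ℓ))
  have hℓk0 : 0 < ℓk := by linarith
  have hM0 : 0 ≤ M := (norm_nonneg _).trans (hM x₀)
  have hℓk5 : (5 : ℝ) ≤ ℓk := by
    rw [hℓk]
    have h : ((ℓ + 1 : ℕ) : ℝ) ^ 1 ≤ ((ℓ + 1 : ℕ) : ℝ) ^ (K - n) := pow_le_pow_right₀ (by exact_mod_cast Nat.succ_le_succ (Nat.zero_le ℓ)) hk1
    have h5 : (5 : ℝ) ≤ ((ℓ + 1 : ℕ) : ℝ) := by exact_mod_cast (by omega : 5 ≤ ℓ + 1)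
    rw [pow_one] at h; linarith
  have hPL : ((((PV 2 ℓ m K hd3 hL).L : ℝ)) ^ (K - n)) = ℓk := by rw [hℓk]
  rw [hPL]
  -- the `hs`-row of `Δ_𝒰φ`
  have hMφ : ∀ z, ∑ j' : Fin 2, ∑ k' : Fin 2, ‖(divB (torusT (PV 2 ℓ m K hd3 hL) 0) (fun κ z => unitsField (toUField W) ⟨z, κ⟩) (fun μ => covD (torusT (PV 2 ℓ m K hd3 hL) 0) (fun κ z => unitsField (toUField W) ⟨z, κ⟩) μ φ) z) j' k'‖ ^ 2
      ≤ (Real.sqrt 2 * M) ^ 2 := by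
    intro z
    refine (sum_norm_sq_le_mul_opNorm_sq _).trans ?_
    rw [mul_pow, Real.sq_sqrt (by norm_num : (0:ℝ) ≤ 2)]
    exact mul_le_mul_of_nonneg_left (pow_le_pow_left₀ (norm_nonneg _) (hM z) 2) (by norm_num)
  -- px4's local energy of the error on the `ℓ_k`-ball
  have H := Hmass hℓ m hm n K a' R hk1 hsize hM8 hR2 α₀ hα₀ hα1 hMα W hreg hwin x₀ ℓk (Real.sqrt 2 * M) hℓk0.le φ φH hH hEL hMφ
  rw [← hℓk, div_self hℓk0.ne'] at H
  have hball : Finset.univ.filter (fun z : Site (PV 2 ℓ m K hd3 hL) 0 => (Site.tdist z x₀ : ℝ) ≤ ℓk)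
      = Finset.univ.filter (fun z : Site (PV 2 ℓ m K hd3 hL) 0 => Site.tdist z x₀ ≤ (PV 2 ℓ m K hd3 hL).L ^ (K - n)) := by
    rw [hℓk]; exact ball_real_pow_eq_nat x₀ (ℓ + 1) (K - n)
  rw [hball] at H
  -- the mass algebra and the ball count
  have hG := sum_hs_covLaplace_le_of_error (fun κ z => unitsField (toUField W) ⟨z, κ⟩) φ φH hM (Finset.univ.filter (fun z : Site (PV 2 ℓ m K hd3 hL) 0 => Site.tdist z x₀ ≤ (PV 2 ℓ m K hd3 hL).L ^ (K - n)))
  have hcard := card_ball_le_real x₀ ((PV 2 ℓ m K hd3 hL).L ^ (K - n))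
  have e3 : (2 * (((((PV 2 ℓ m K hd3 hL).L ^ (K - n) : ℕ) : ℝ)) + 1)) ^ (PV 2 ℓ m K hd3 hL).d = (2 * (ℓk + 1)) ^ 3 := by
    rw [hℓk]; push_cast; rfl
  rw [e3] at hcard
  have hcard' : (((Finset.univ.filter (fun z : Site (PV 2 ℓ m K hd3 hL) 0 => Site.tdist z x₀ ≤ (PV 2 ℓ m K hd3 hL).L ^ (K - n))).card : ℝ)) ≤ 27 * ℓk ^ 3 := by
    refine hcard.trans ?_
    nlinarith [pow_le_pow_left₀ (by positivity : (0:ℝ) ≤ 2 * (ℓk + 1)) (by linarith : 2 * (ℓk + 1) ≤ 3 * ℓk) 3]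
  have hs2 : (Real.sqrt 2 * M) ^ 2 = 2 * M ^ 2 := by rw [mul_pow, Real.sq_sqrt (by norm_num : (0:ℝ) ≤ 2)]
  rw [hs2] at H
  have hN2 : (((2 : ℕ) : ℝ)) * M ^ 2 = 2 * M ^ 2 := by norm_num
  rw [hN2] at hG
  have hM2 : 0 ≤ M ^ 2 := sq_nonneg _
  have h1 : 2 * (((Finset.univ.filter (fun z : Site (PV 2 ℓ m K hd3 hL) 0 => Site.tdist z x₀ ≤ (PV 2 ℓ m K hd3 hL).L ^ (K - n))).card : ℝ)) * (2 * M ^ 2)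
      ≤ 2 * (27 * ℓk ^ 3) * (2 * M ^ 2) :=
    mul_le_mul_of_nonneg_right (mul_le_mul_of_nonneg_left hcard' (by norm_num)) (by positivity)
  have e : (108 + 4 * Real.exp 1 * CE) * ℓk ^ 3 * M ^ 2 = 2 * (27 * ℓk ^ 3) * (2 * M ^ 2) + 2 * (CE * Real.exp 1 * ℓk ^ 3 * (2 * M ^ 2)) := by ring
  rw [e]
  linarith

end MemberData

/-! ## §3 ★★★ The `hK₂sup` row at the member of record -/

section Member

variable {ℓ : ℕ} {hL : Odd (ℓ + 1) ∧ 1 < ℓ + 1}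

/-- ★★★ **THE (hK₂-cov) SUPPLIER ROW AT THE MEMBER** (see the module docstring): the `hK₂sup` binder of ✓ `Prop7LinearCorrectorClose.linCorr_gauge_le_of_supplier_rows` holds for
`F = ⟨ℓ+1, hL, m, hm⟩` and every `W ∈ RegPr` of the member of record, with an absolute `C₂` (depending on `ℓ` only through px4 g3's `c₃₅, a₅, C_E` and on the flat constants of F4b-cov).
[cite: Balaban1985Variational, Prop. 7 p.299; Balaban1985BackgroundPropagators, (3.8) p.392, (3.35) p.396; Balaban1985RegularSpaces, (1.33) p.82] -/
theorem weight_row_member (hℓ4 : 4 ≤ ℓ) : ∃ c35 a₅ C₂ : ℝ, 0 < c35 ∧ 0 < a₅ ∧ 0 < C₂ ∧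
    ∀ (hℓ : 4 ≤ ℓ) (m : ℕ) (hm : 1 ≤ m) (n K a' R : ℕ) (hk1 : 1 ≤ K - n) (hsize : a' + 3 ≤ m + n) (hM8 : 8 ≤ (ℓ + 1) ^ a')
      (hR2 : 2 * (ℓ + 1) ^ 2 ≤ R) (h1024 : 1024 ≤ (ℓ + 1) ^ (K - n)) (α₀ : ℝ), 0 < α₀ → α₀ ≤ 1 → ((ℓ + 1 : ℕ) : ℝ) * (((ℓ + 1) ^ a' : ℕ) : ℝ) * α₀ ≤ a₅ →
      ∀ W : GaugeField (PV 2 ℓ m K hd3 hL) 0 (Matrix.specialUnitaryGroup (Fin 2) ℂ),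
        RegPr (⟨ℓ + 1, hL, m, hm⟩ : T3Family) n K α₀ W →
        (4 * 2197 * (24 * 289 * 24576 * 46116) : ℝ) * ((2 : ℕ) : ℝ) ^ 2 * ((((PV 2 ℓ m K hd3 hL).L : ℝ)) ^ (K - n)) ^ 4
            * ((((PV 2 ℓ m K hd3 hL).d : ℝ)) ^ 2 * (4 * ((2 : ℕ) : ℝ) * (α₀ * ((((PV 2 ℓ m K hd3 hL).L : ℝ))⁻¹) ^ (2 * (K - n))) ^ 2
              + (2 * ((((ℓ + 1 : ℕ) : ℝ) ^ (K - n))⁻¹ * ((((ℓ + 1 : ℕ) : ℝ) ^ (K - n))⁻¹ * (c35 * (((ℓ + 1 : ℕ) : ℝ) * (((ℓ + 1) ^ a' : ℕ) : ℝ)) * α₀))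
                  * Real.exp ((((ℓ + 1 : ℕ) : ℝ) ^ (K - n))⁻¹ * (c35 * (((ℓ + 1 : ℕ) : ℝ) * (((ℓ + 1) ^ a' : ℕ) : ℝ)) * α₀)))
                + 4 * ((((ℓ + 1 : ℕ) : ℝ) ^ (K - n))⁻¹ * (c35 * (((ℓ + 1 : ℕ) : ℝ) * (((ℓ + 1) ^ a' : ℕ) : ℝ)) * α₀)
                  * Real.exp ((((ℓ + 1 : ℕ) : ℝ) ^ (K - n))⁻¹ * (c35 * (((ℓ + 1 : ℕ) : ℝ) * (((ℓ + 1) ^ a' : ℕ) : ℝ)) * α₀))) ^ 2) ^ 2)) ≤ 1 / 4 →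
        ∀ (φ φH : Site (PV 2 ℓ m K hd3 hL) 0 → Matrix (Fin 2) (Fin 2) ℂ),
          (∀ y : Site (PV 2 ℓ m K hd3 hL) (K - n), φH (embIter (K - n) y) = φ (embIter (K - n) y)) →
          (∀ x : Site (PV 2 ℓ m K hd3 hL) 0, x ∉ Set.range (embIter (K - n)) →
            divB (torusT (PV 2 ℓ m K hd3 hL) 0) (fun κ z => unitsField (toUField W) ⟨z, κ⟩) (fun μ => covD (torusT (PV 2 ℓ m K hd3 hL) 0) (fun κ z => unitsField (toUField W) ⟨z, κ⟩) μ
                (fun y => divB (torusT (PV 2 ℓ m K hd3 hL) 0) (fun κ z => unitsField (toUField W) ⟨z, κ⟩) (fun ν => covD (torusT (PV 2 ℓ m K hd3 hL) 0) (fun κ z => unitsField (toUField W) ⟨z, κ⟩) ν φH) y)) x = 0) →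
          ∀ M : ℝ, (∀ z, ‖divB (torusT (PV 2 ℓ m K hd3 hL) 0) (fun κ z => unitsField (toUField W) ⟨z, κ⟩) (fun μ => covD (torusT (PV 2 ℓ m K hd3 hL) 0) (fun κ z => unitsField (toUField W) ⟨z, κ⟩) μ φ) z‖ ≤ M) →
          ∀ w' : Site (PV 2 ℓ m K hd3 hL) 0 → ℝ,
            (∀ (x : Site (PV 2 ℓ m K hd3 hL) 0) (y : Site (PV 2 ℓ m K hd3 hL) (K - n)), w' x ≤ (Site.tdist x (embIter (K - n) y) : ℝ)) →
            (∀ x, w' x ≤ (((⟨ℓ + 1, hL, m, hm⟩ : T3Family).L : ℕ) : ℝ) ^ (K - n)) → (∀ x, 0 ≤ w' x) →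
          ∀ x : Site (PV 2 ℓ m K hd3 hL) 0,
            w' x * ‖divB (torusT (PV 2 ℓ m K hd3 hL) 0) (fun κ z => unitsField (toUField W) ⟨z, κ⟩) (fun μ => covD (torusT (PV 2 ℓ m K hd3 hL) 0) (fun κ z => unitsField (toUField W) ⟨z, κ⟩) μ (fun y => φ y - φH y)) x‖
              ≤ C₂ * (((⟨ℓ + 1, hL, m, hm⟩ : T3Family).L : ℕ) : ℝ) ^ (K - n) * M := by
  obtain ⟨a₅f, T₀, ha₅f, hT₀, HF⟩ := member_frames (hL := hL) hℓ4
  obtain ⟨c35, a₅m, CV, hc35, ha₅m, hCV, HM⟩ := member_mass (hL := hL) hℓ4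
  obtain ⟨A, hA, Hrow⟩ := weight_mul_norm_covLaplace_interp_error_le (N := 2)
  refine ⟨c35, min a₅f a₅m, 1 + A * 81 * (1 + T₀) ^ 2 * Real.sqrt CV, hc35, lt_min ha₅f ha₅m, by positivity, ?_⟩
  intro hℓ m hm n K a' R hk1 hsize hM8 hR2 h1024 α₀ hα₀ hα1 hMα W hreg hwin φ φH hH hEL M hM w' hwC hwℓ hw0 x
  obtain ⟨t, τ₁, τ₂, ht0, htT, hτ₁, hτ₂, hfr⟩ := HF hℓ m hm n K a' R hk1 hsize hM8 hR2 α₀ hα₀ (hMα.trans (min_le_left _ _)) W hreg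
  have hmass := HM hℓ m hm n K a' R hk1 hsize hM8 hR2 α₀ hα₀ hα1 (hMα.trans (min_le_right _ _)) W hreg hwin φ φH hH hEL M hM
  have hFL : (((⟨ℓ + 1, hL, m, hm⟩ : T3Family).L : ℕ) : ℝ) ^ (K - n) = (((PV 2 ℓ m K hd3 hL).L : ℝ)) ^ (K - n) := rfl
  rw [hFL] at hwℓ ⊢
  have hd : (PV 2 ℓ m K hd3 hL).d = 3 := rfl
  have hk : K - n ≤ (PV 2 ℓ m K hd3 hL).m + (PV 2 ℓ m K hd3 hL).K := show K - n ≤ m + K by omega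
  have h1024' : 1024 ≤ (PV 2 ℓ m K hd3 hL).L ^ (K - n) := h1024
  have hUu := fun (ν : Fin (PV 2 ℓ m K hd3 hL).d) (z : Site (PV 2 ℓ m K hd3 hL) 0) => unitsField_toUField_mem_unitary W ν z
  have hU := fun (κ : Fin (PV 2 ℓ m K hd3 hL).d) (z : Site (PV 2 ℓ m K hd3 hL) 0) => unitsField_toUField_norm_le_one W ⟨z, κ⟩
  have H := Hrow (PV 2 ℓ m K hd3 hL) hd (K - n) hk h1024' (fun κ z => unitsField (toUField W) ⟨z, κ⟩) hUu hU φ φH hEL M hM t τ₁ τ₂ ht0 hτ₁ hτ₂ hfr _ hmass w' hwC hwℓ hw0 x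
  have h81 : (1 + 2 * ((2 : ℕ) : ℝ) ^ 2) ^ 2 = 81 := by norm_num
  rw [h81] at H
  have hℓk1 : (1 : ℝ) ≤ (((PV 2 ℓ m K hd3 hL).L : ℝ)) ^ (K - n) := one_le_pow₀ (by exact_mod_cast (PV 2 ℓ m K hd3 hL).L_pos)
  have hM0 : 0 ≤ M := (norm_nonneg _).trans (hM x)
  exact H.trans (final_algebra hA.le ht0 htT hCV.le hℓk1 hM0)

end Member

end Summit.QuantumFields.YangMills.Theorems.Prop7CovWeightedRowMember

end
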